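import Summits.CriticalPhenomena.CardyFormulaZ2.Theses.CardyLeeYang
import Literature.Probability.Percolation.LatticeTraceGeometry
import HarnessLib

/-!
# Birth skeleton `Lines/birth.lean` for the crux `CardyLeeYang.CrossingNumberRealRoots`
(item `stmt-CriticalPhenomena-16787`, route `route-CriticalPhenomena-CardyLeeYang`, sub-problem
`CardyFormulaZ2`; BC3 skeleton registered by the skeleton registrar
`skel-stmt-CriticalPhenomena-16787`, 2026-08-17)

The crux (rank 2 of the route, "PTAR at every mesh"): for every conformal rectangle `R` and every
mesh `δ > 0`, with `G_ω = openGraph ω ⊓ discreteDomainGraph R.carrier δ` (bond percolation on `ℤ²` at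
`p = 1/2` seen through G02's discretisation `Ω_δ`) and `N` = the number of `G_ω`-clusters meeting both
discrete arcs `discreteArc Ω δ (R.arc 0)` and `discreteArc Ω δ (R.arc 2)` (the events `{N ≥ k}` are
spelled out with `k` pairwise `G_ω`-disconnected arc-0 sites each `G_ω`-joined to arc 2), the law of `N`
is Poisson-binomial: `P(N = k) = [X^k] ∏ᵢ ((1 − pᵢ) + pᵢ X)` for some `p₁, …, pₙ ∈ [0,1]`.

## The line: real-rooted PGF ⟵ PTAR on LATTICE QUADS ⟵ G02 produces a lattice quad

This is the route's own two-layer plan for this crux ("interlacing/TP architecture on planar two-arc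
graphs" + "discretisation bookkeeping: the G02 domain of a conformal rectangle is a planar two-arc
graph up to lattice-scale surgery"), cut into its three genuinely different pieces of mathematics:

* `stub_pgfFactorisation` — ALGEBRA (classical, provable now; size M in Lean): a real polynomial with
  non-negative coefficients, value `1` at `1` and all its roots real (`q.roots.card = q.natDegree`,
  Mathlib's splitting criterion `Polynomial.splits_iff_card_roots`) is a product of Bernoulli factors
  `∏ᵢ (C (1 − pᵢ) + C pᵢ * X)` with `pᵢ ∈ [0,1]` (roots are `≤ 0`; `X + s = (1+s)((1−p) + pX)` with
  `p = 1/(1+s)`; the normalisation `q(1) = 1` absorbs the constants). Every proof architecture of the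
  card (interlacing preservers, Karlin TP ⇒ PF, Lee–Yang) delivers "the PGF has only real zeros"; the
  route decl is typed in the coefficient form, so this conversion is a lemma of the line, not décor.
* `stub_latticeQuadRealRoots` — THE COMBINATORIAL HEART (open; size XL): **PTAR for lattice quads, at
  every edge density `p`.** A *lattice quad* `IsLatticeQuad H A B` is the typed form of "finite simply
  connected planar two-arc graph" for subgraphs of `ℤ²`: `H ≤ zdGraph 2` with finitely many edges;
  finite disjoint vertex sets `A, B`; **square-faced** (every lattice edge whose midpoint is enclosed —
  `Percolation.EnclosesPoint`, the tree's winding/boundedness notion — by a closed lattice walk made of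
  `H`-edges is itself an `H`-edge: all bounded faces of `H` are unit squares, no holes); `A ∪ B` **outer**
  (no site of `A ∪ B` is enclosed by such a walk); and `A, B` **non-interlaced** (any two distinct sites
  of `A` and any two distinct sites of `B` are joined by vertex-disjoint `H`-walks — for 2-connected `H`
  this is exactly "A and B lie in two disjoint intervals of the outer cycle"). Conclusion: the crossing
  number `N(H, A, B)` of `openGraph ω ⊓ H` under `bondPercolation (zdGraph 2) p` has a real-rooted
  probability generating polynomial `q` (`P(N = k) = q.coeff k`, `q(1) = 1`, `q.roots.card =
  q.natDegree`). Boxes `[0,m]×[0,n]` with `A, B` sub-intervals of the left/right columns are lattice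
  quads, so this contains the route's support item `BoxCrossingNumberRealRoots` (card census: widths
  ≤ 7, 8×7, 250 sub-arc polynomials, 13 boxes re-checked exactly — 0 failures) and is refutable by ONE
  exact enumeration. NEW EXPOSURE made visible by the typing (untested by the card's census, the first
  thing a refuter should compute): G02's discrete arcs are cut out of `meshBoundary`, which misses the
  reflex (concave) lattice corners of `Ω_δ`, so the arcs of a G02 quad have one-site GAPS at every reflex
  corner — the class therefore allows non-contiguous (but non-interlaced) `A, B`; cheapest falsifier: an
  L-shaped / staircase lattice region with arcs spanning reflex corners, exact dyadic arithmetic + Sturm.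
* `stub_discretisedRectangleIsLatticeQuad` — GEOMETRY/TOPOLOGY of G02 (size M–L): for every conformal
  rectangle `R` and `δ > 0`, `(discreteDomainGraph R.carrier δ, discreteArc _ _ (R.arc 0),
  discreteArc _ _ (R.arc 2))` is a lattice quad. `le_zdGraph`, finiteness (bounded carrier,
  `meshDomain_finite`) are bookkeeping; square-facedness and outerness are Jordan-curve arguments (a
  lattice polygon `P ⊆ Ω̄` made of `Ω_δ`-edges encloses no exterior point because the exterior of the
  Jordan curve is connected and unbounded, hence its inside lies in `int(Ω̄) = Ω` and every enclosed
  lattice edge is a mesh edge of the largest component; a `meshBoundary` site has a missing lattice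
  edge, whose midpoint would be enclosed with it); non-interlacing and disjointness of the two discrete
  arcs hold whenever the mesh resolves the four arcs, and FAIL exactly at the lattice-scale pathologies
  the route's why-might-fail names (distance ties between arcs 0 and 2, pinches shared by both arcs,
  interlaced closest-arc cells of a rough Jordan boundary) — this stub is where that risk now lives,
  typed; its refutation by such an `(R, δ)` re-types the line on rectilinear / smooth `R` (the route's
  recorded fallback) without touching the combinatorial heart.

Composition `CrossingNumberRealRoots_of` (REAL proof, no `sorry`): given `R, δ, hδ`, stub 3 puts the
G02 data in the class, stub 2 (at `p = half`) gives the real-rooted PGF `q` with the coefficient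
identity, the composition proves `0 ≤ q.coeff k` itself (monotonicity `{N ≥ k+1} ⊆ {N ≥ k}` by dropping
the last marked site, `measureReal_mono`), stub 1 factors `q`, and the coefficient identity is literally
the route decl's conclusion (its `let`s ζ-reduced). Its conclusion is the route decl BY NAME.

Device (D-0027 §3.3, as in `Cruxes/CardyRectangle/Lines/birth.lean`): each stub is a sorried theorem
`Holds.stub_<name> : <full statement over tree declarations>` (registered under the short name
`stub_<name>` with that text) plus the by-name handle `def stub_<name> : Prop := type_of% Holds.stub_<name>`;
the hypotheses of `CrossingNumberRealRoots_of` are exactly the three handles, and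
`CrossingNumberRealRoots_proof` applies it to the three sorried stubs. Sorries: exactly the three
`Holds.stub_*`; nothing else.

Disproof used: none — no `Disproof.lean`, no `Negative/` lemma and no other workfile exists for this crux
at registration (`ledger crux ls stmt-CriticalPhenomena-16787`: "(no workfiles yet)", 2026-08-17); the
negatives index of the summit (11 refuted statements; on this sub-problem `not_SymmetryUpgrade` stmt-0698,
JunctionShadowing stmt-8581, degenerate arcs stmt-0748, DualCurrentTemplate stmt-6949) has no statement
about crossing numbers, Poisson-binomial laws, real-rooted polynomials or lattice quads. No stub is a
restatement: stub 1 is pure polynomial algebra, stub 2 speaks of abstract subgraphs of `ℤ²` and needs the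
class certificate that only stub 3 provides, stub 3 contains no probability at all; the cheap probes
`stub → CrossingNumberRealRoots` / `stub → CardyFormulaZ2` fail for all three (BC3, `Lines/birth.md`).
-/

noncomputable section

namespace Summit.CriticalPhenomena.CardyFormulaZ2.Cruxes.CrossingNumberRealRoots.Birth

open Literature.Probability.LatticeModels
open Literature.Probability.Percolation
open Literature.Probability.RandomPlanarGeometry (ConformalRectangle)
open Polynomial MeasureTheory

/-! ### The class of lattice quads (typed "finite simply connected planar two-arc subgraph of `ℤ²`") -/

/-- **Lattice quad.** `H` is a subgraph of the square lattice with finitely many edges, `A` and `B`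
are finite disjoint vertex sets ("the two discrete arcs"), and:
* `squareFaced` — no holes: every lattice edge whose midpoint is enclosed (`EnclosesPoint`: off the
  trace, bounded complementary component) by a closed lattice walk made of `H`-edges is an `H`-edge, so
  every bounded face of the plane graph `H` is a unit square with its four sides in `H`;
* `outer` — every site of `A ∪ B` lies on the outer face: it is enclosed by no closed walk of `H`;
* `nonInterlaced` — any two distinct sites of `A` and any two distinct sites of `B` are joined by
  vertex-disjoint walks of `H` (for a 2-connected `H` with outer cycle `C`: `A` and `B` lie in two
  disjoint intervals of `C`; by planarity interlaced boundary quadruples admit no such disjoint pair).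
This is the H21 typing of the card's "one colour / two contiguous arcs / simply connected planar graph"
regime for subgraphs of `ℤ²` (annuli, interlaced targets and non-planar graphs — the card's failing
controls — are excluded by `outer`/`squareFaced`, `nonInterlaced`, `le_zdGraph` respectively); the
arcs may have gaps (G02's `meshBoundary` misses reflex lattice corners). -/
structure IsLatticeQuad (H : SimpleGraph (Site 2)) (A B : Set (Site 2)) : Prop where
  /-- `H` is a subgraph of the nearest-neighbour graph `ℤ²`. -/
  le_zdGraph : H ≤ zdGraph 2
  /-- `H` has finitely many edges. -/
  edgeSet_finite : H.edgeSet.Finite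
  /-- The first arc is finite. -/
  left_finite : A.Finite
  /-- The second arc is finite. -/
  right_finite : B.Finite
  /-- The two arcs are disjoint. -/
  disjoint : Disjoint A B
  /-- No holes: a lattice edge whose midpoint is enclosed by a closed walk of `H` is an edge of `H`. -/
  squareFaced : ∀ (u : Site 2) (w : (zdGraph 2).Walk u u), (∀ e ∈ w.edges, e ∈ H.edgeSet) →
    ∀ x y : Site 2, (zdGraph 2).Adj x y →
      EnclosesPoint ((Site.toComplex x + Site.toComplex y) / 2) w → H.Adj x y
  /-- The arcs lie on the outer face: no site of `A ∪ B` is enclosed by a closed walk of `H`. -/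
  outer : ∀ x ∈ A ∪ B, ∀ (u : Site 2) (w : (zdGraph 2).Walk u u), (∀ e ∈ w.edges, e ∈ H.edgeSet) →
    ¬ EnclosesPoint (Site.toComplex x) w
  /-- The arcs are not interlaced around the outer face. -/
  nonInterlaced : ∀ ⦃a₁ a₂ b₁ b₂ : Site 2⦄, a₁ ∈ A → a₂ ∈ A → b₁ ∈ B → b₂ ∈ B → a₁ ≠ a₂ → b₁ ≠ b₂ →
    ∃ (P : H.Walk a₁ a₂) (Q : H.Walk b₁ b₂), List.Disjoint P.support Q.support

/-! ### The three registered stubs (the ONLY `sorry`s of this file) and their by-name handles -/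

/-- **Stub 1 — real-rooted probability generating polynomials factor into Bernoulli factors (algebra,
provable now, size M).** A real polynomial with non-negative coefficients, `q(1) = 1` and
`q.roots.card = q.natDegree` (all roots real, `Polynomial.splits_iff_card_roots`) equals
`∏ᵢ (C (1 − pᵢ) + C pᵢ * X)` for some `p : Fin n → [0,1]` (roots are `≤ 0` since the coefficients are
`≥ 0`; write `X + s = (1 + s)·((1 − p) + p X)`, `p = (1 + s)⁻¹ ∈ (0,1]`, and use `q(1) = 1`).
Sources: Pitman, J. Combin. Theory A 77 (1997) §1 (PF sequences / Poisson-binomial laws);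
Brändén 2014 (arXiv:1410.6601) §2. -/
protected theorem Holds.stub_pgfFactorisation : ∀ q : Polynomial ℝ, (∀ k : ℕ, 0 ≤ q.coeff k) → q.eval 1 = 1 → Multiset.card q.roots = q.natDegree → ∃ (n : ℕ) (p : Fin n → ℝ), (∀ i, 0 ≤ p i ∧ p i ≤ 1) ∧ (∏ i, (Polynomial.C (1 - p i) + Polynomial.C (p i) * Polynomial.X)) = q := by
  sorry

/-- By-name handle of the registered stub `Holds.stub_pgfFactorisation`. -/
def stub_pgfFactorisation : Prop := type_of% Holds.stub_pgfFactorisation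

/-- **Stub 2 — PTAR for lattice quads at every edge density (the combinatorial heart; open, size XL).**
For every `p ∈ [0,1]` and every lattice quad `(H, A, B)`, the number `N` of clusters of
`openGraph ω ⊓ H` meeting both `A` and `B` (events `{N ≥ k}`: `k` pairwise disconnected sites of `A`
each joined to `B`) has, under `bondPercolation (zdGraph 2) p`, a real-rooted probability generating
polynomial: `∃ q : ℝ[X]`, `P(N ≥ k) − P(N ≥ k+1) = q.coeff k` for all `k`, `q(1) = 1`,
`q.roots.card = q.natDegree`. Architecture (card K1): linear preservers of mutual interlacing under
row growth / complementary-arc deletion–contraction (Brändén 2014 §7–8, Borcea–Brändén 2009,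
Heilmann–Lieb 1972, Chudnovsky–Seymour 2007), or Karlin's TP ⇒ PF for the chain of successive lowest
open / closed-dual crossings (Karlin 1964, Karlin–McGregor 1959). Contains `BoxCrossingNumberRealRoots`. -/
protected theorem Holds.stub_latticeQuadRealRoots : ∀ (p : unitInterval) (H : SimpleGraph (Literature.Probability.LatticeModels.Site 2)) (A B : Set (Literature.Probability.LatticeModels.Site 2)), IsLatticeQuad H A B → ∃ q : Polynomial ℝ, (∀ k : ℕ, (Literature.Probability.Percolation.bondPercolation (Literature.Probability.LatticeModels.zdGraph 2) p).real {ω | ∃ x : Fin k → Literature.Probability.LatticeModels.Site 2, (∀ i, x i ∈ A ∧ ∃ y ∈ B, (Literature.Probability.Percolation.openGraph ω ⊓ H).Reachable (x i) y) ∧ ∀ i j, i ≠ j → ¬ (Literature.Probability.Percolation.openGraph ω ⊓ H).Reachable (x i) (x j)} - (Literature.Probability.Percolation.bondPercolation (Literature.Probability.LatticeModels.zdGraph 2) p).real {ω | ∃ x : Fin (k + 1) → Literature.Probability.LatticeModels.Site 2, (∀ i, x i ∈ A ∧ ∃ y ∈ B, (Literature.Probability.Percolation.openGraph ω ⊓ H).Reachable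 (x i) y) ∧ ∀ i j, i ≠ j → ¬ (Literature.Probability.Percolation.openGraph ω ⊓ H).Reachable (x i) (x j)} = q.coeff k) ∧ q.eval 1 = 1 ∧ Multiset.card q.roots = q.natDegree := by
  sorry

/-- By-name handle of the registered stub `Holds.stub_latticeQuadRealRoots`. -/
def stub_latticeQuadRealRoots : Prop := type_of% Holds.stub_latticeQuadRealRoots

/-- **Stub 3 — G02's discretisation of a conformal rectangle is a lattice quad (geometry/topology,
size M–L).** For every conformal rectangle `R` and `δ > 0`, the graph `Ω_δ = discreteDomainGraph
R.carrier δ` with the discrete arcs of `R.arc 0` and `R.arc 2` is a lattice quad: subgraph of `ℤ²`,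
finite (bounded carrier, `meshDomain_finite`), square-faced and outer arcs (Jordan-curve arguments: a
closed walk of `Ω_δ` traces a polygon in `Ω̄` whose inside meets no point of the connected unbounded
exterior, hence lies in `int Ω̄ = Ω`; every enclosed lattice edge is then a mesh edge of the largest
component, and a `meshBoundary` site — one with a missing lattice edge — cannot be enclosed), disjoint
and non-interlaced discrete arcs (closest-arc cells of the two opposite arcs; this is where the
lattice-scale pathologies of rough Jordan boundaries — ties, shared pinches, interlacing — are now typed).
Sources: Smirnov 2001 §2 (discretisation); Chelkak–Smirnov 2012 §1.2; Werner 2007 §2–3. -/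
protected theorem Holds.stub_discretisedRectangleIsLatticeQuad : ∀ (R : Literature.Probability.RandomPlanarGeometry.ConformalRectangle) (δ : ℝ), 0 < δ → IsLatticeQuad (Literature.Probability.LatticeModels.discreteDomainGraph R.carrier δ) (Literature.Probability.LatticeModels.discreteArc R.carrier δ (R.arc 0)) (Literature.Probability.LatticeModels.discreteArc R.carrier δ (R.arc 2)) := by
  sorry

/-- By-name handle of the registered stub `Holds.stub_discretisedRectangleIsLatticeQuad`. -/
def stub_discretisedRectangleIsLatticeQuad : Prop := type_of% Holds.stub_discretisedRectangleIsLatticeQuad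

/-! ### The composition: the three stubs imply the crux, by name (no `sorry`) -/

/-- Monotonicity of the events `{N ≥ k}` in `k`: forgetting the last of `k + 1` pairwise disconnected
marked sites of `A` joined to `B` leaves `k` of them. [folklore] -/
theorem atLeast_succ_subset (G : BondConfig (Site 2) → SimpleGraph (Site 2)) (A B : Set (Site 2))
    (k : ℕ) :
    {ω : BondConfig (Site 2) | ∃ x : Fin (k + 1) → Site 2,
        (∀ i, x i ∈ A ∧ ∃ y ∈ B, (G ω).Reachable (x i) y) ∧
          ∀ i j, i ≠ j → ¬ (G ω).Reachable (x i) (x j)} ⊆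
      {ω | ∃ x : Fin k → Site 2,
        (∀ i, x i ∈ A ∧ ∃ y ∈ B, (G ω).Reachable (x i) y) ∧
          ∀ i j, i ≠ j → ¬ (G ω).Reachable (x i) (x j)} := by
  rintro ω ⟨x, hx, hdis⟩
  exact ⟨fun i => x (Fin.castSucc i), fun i => hx (Fin.castSucc i),
    fun i j hij => hdis _ _ fun h => hij (Fin.castSucc_injective _ h)⟩

/-- **`CrossingNumberRealRoots` from the three stubs.** Given `R`, `δ > 0`: stub 3 certifies that the
G02 data is a lattice quad; stub 2 (at `p = 1/2`) yields a real-rooted PGF `q` whose coefficients are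
the point probabilities of `N`; these are non-negative (`atLeast_succ_subset` + `measureReal_mono`), so
stub 1 writes `q` as a product of Bernoulli factors, and the coefficient identity is the route decl's
conclusion with its `let`s reduced. The conclusion is literally the route declaration. -/
theorem CrossingNumberRealRoots_of (h₁ : stub_pgfFactorisation) (h₂ : stub_latticeQuadRealRoots)
    (h₃ : stub_discretisedRectangleIsLatticeQuad) :
    Summit.CriticalPhenomena.CardyFormulaZ2.Theses.CardyLeeYang.CrossingNumberRealRoots := by
  intro R δ hδ
  dsimp only
  obtain ⟨q, hcoeff, hone, hroots⟩ :=
    h₂ half (discreteDomainGraph R.carrier δ) (discreteArc R.carrier δ (R.arc 0))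
      (discreteArc R.carrier δ (R.arc 2)) (h₃ R δ hδ)
  have hnonneg : ∀ k : ℕ, 0 ≤ q.coeff k := by
    intro k
    rw [← hcoeff k, sub_nonneg]
    exact measureReal_mono
      (atLeast_succ_subset (fun ω => openGraph ω ⊓ discreteDomainGraph R.carrier δ)
        (discreteArc R.carrier δ (R.arc 0)) (discreteArc R.carrier δ (R.arc 2)) k)
  obtain ⟨n, p, hp, hq⟩ := h₁ q hnonneg hone hroots
  refine ⟨n, p, hp, fun k => ?_⟩
  rw [hq]
  exact hcoeff k

/-- **Skeleton theorem** (registry shape `<Crux>_proof : <crux decl> := <line>_of stub₁ … stub_k`): the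
crux from the three registered (sorried) stubs through `CrossingNumberRealRoots_of`. It becomes the crux
proof when the last stub is discharged; it contains no `sorry` of its own (and certifies mechanically
that the three handles ARE the stub statements). -/
theorem CrossingNumberRealRoots_proof :
    Summit.CriticalPhenomena.CardyFormulaZ2.Theses.CardyLeeYang.CrossingNumberRealRoots :=
  CrossingNumberRealRoots_of Holds.stub_pgfFactorisation Holds.stub_latticeQuadRealRoots
    Holds.stub_discretisedRectangleIsLatticeQuad

end Summit.CriticalPhenomena.CardyFormulaZ2.Cruxes.CrossingNumberRealRoots.Birth

end
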